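import Summits.NavierStokesRegularity.NavierStokesRegularity.Theorems.TypeIIInviscidRelaxationOneSidedRadialCriterionIffSubcriticalCoreReynolds
import Summits.NavierStokesRegularity.NavierStokesRegularity.Theorems.TypeIIInviscidRelaxationOneSidedRadialCriterionOneThinCore
import HarnessLib

/-!
# Crux `OneSidedRadialCriterion` (stmt-NavierStokesRegularity-19059) ⟺ ONE THIN SUBCRITICAL CORE, BY NAME

`--supports stmt-NavierStokesRegularity-19059` (helper file; theorems only, no definitions, no `sorry`).

The registered stub of the line `subcritical_core_reynolds` asks, under the gate `r u_r ≥ −Cν` on `{r < δ} × [0,T)`,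
for a subcritical level `d₀ < 2` valid in EVERY parabolic core `r < ξ√(ν(T−t))` near `T`
(`SubcriticalCoreReynolds.oneSidedRadialCriterion_iff_subcriticalCoreReynolds`).  With the any-level thin-core criterion
(`RadialInflowPlateau.hasSmoothExtensionPast_of_oneThinSubcriticalCore`) ONE core of ONE width suffices, for every gate
constant; with the necessity (`SubcriticalCoreReynolds.vanishingCoreReynolds_of_hasSmoothExtensionPast`) this gives:

* `hasSmoothExtensionPast_iff_oneThinSubcriticalCore` — per solution, under the gate: continuation past `T` ⟺
  `∃ d₀ < 2, ∃ ξ > 0, ∃ T₁ < T`, `u_r ≥ −ν d₀/r` for `T₁ ≤ t < T`, `0 < r < δ`, `r < ξ√(ν(T−t))`;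
* `oneSidedRadialCriterion_iff_oneThinSubcriticalCore` — BY NAME: the crux ⟨19059⟩ is equivalent to the formally
  WEAKEST door «under the gate, some parabolic core, however thin, is eventually subcritical» (recommended reshape of
  `stub_subcriticalCoreReynolds`: `∀ ξ` ↦ `∃ ξ`).

So the three typed forms — «SOME thin core subcritical», «EVERY core subcritical» (registered stub), «core Reynolds number
→ 0» (`…_iff_vanishingCoreReynolds`) — are one statement, and a gated axisymmetric singularity (any `C`) must carry
inflow Reynolds numbers in `[2 − o(1), C]` along points with `r/√(ν(T−t)) → 0` up to the blow-up time
(`RadialInflowPlateau.nearCritical_deepCore_of_blowup`).  HONEST FRAMING: equivalence layer over a new criterion; the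
content of ⟨19059⟩ for `C ≥ 2` (existence of one thin subcritical core) is NOT proved; nothing about Navier–Stokes
regularity is claimed. [new]
-/

noncomputable section

open Set Real Literature.Analysis.FluidPDE

namespace Summit.NavierStokesRegularity.NavierStokesRegularity.Theorems.SubcriticalCoreReynolds

-- the problem directory repeats the summit name (`NavierStokesRegularity/NavierStokesRegularity`)
set_option linter.dupNamespace false

open Summit.NavierStokesRegularity.NavierStokesRegularity.Theorems RadialInflowPlateau
open Summit.NavierStokesRegularity.NavierStokesRegularity.Theses.TypeIIInviscidRelaxation (OneSidedRadialCriterion)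

/-- **Per-solution equivalence (any gate constant).** In the standing class under the gate `r u_r ≥ −Cν` on
`{r < δ} × [0,T)`: the solution extends smoothly past `T` iff ONE parabolic core of ONE width is eventually
subcritical. [new] -/
theorem hasSmoothExtensionPast_iff_oneThinSubcriticalCore {ν T C δ : ℝ} (hν : 0 < ν) (hT : 0 < T) (hδ : 0 < δ)
    {u : ℝ → EuclideanSpace ℝ (Fin 3) → EuclideanSpace ℝ (Fin 3)} {p : ℝ → EuclideanSpace ℝ (Fin 3) → ℝ}
    (hcl : IsClassicalNSSolutionOn (Ico 0 T) ν 0 u p) (hLH : IsLerayHopfOn T ν 0 (u 0) u)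
    (hbd : ∀ T' < T, ∃ M : ℝ, ∀ t ∈ Icc 0 T', ∀ x, ‖u t x‖ ≤ M)
    (hax : ∀ t ∈ Ico 0 T, IsAxisymmetric (u t)) (hdec : HasRapidSpatialDecay (u 0))
    (hgate : ∀ t ∈ Ico 0 T, ∀ x : EuclideanSpace ℝ (Fin 3), cylRadius x < δ →
      -(C * ν) ≤ x 0 * u t x 0 + x 1 * u t x 1) :
    HasSmoothExtensionPast ν 0 u T ↔
      ∃ d₀ ξ T₁ : ℝ, 0 < d₀ ∧ d₀ < 2 ∧ 0 < ξ ∧ T₁ < T ∧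
        ∀ t ∈ Ico 0 T, T₁ ≤ t → ∀ x : EuclideanSpace ℝ (Fin 3), 0 < cylRadius x → cylRadius x < δ →
          cylRadius x < ξ * √(ν * (T - t)) → -(ν * d₀ / cylRadius x) ≤ radialVelocity (u t) x := by
  refine ⟨fun hext => ?_, fun h => hasSmoothExtensionPast_of_oneThinSubcriticalCore hν hT hδ hcl hLH hbd hax hdec hgate h⟩
  obtain ⟨T₁, hT₁, h⟩ := vanishingCoreReynolds_of_hasSmoothExtensionPast (δ := δ) hν hT hcl hLH hbd hax hext 1 one_pos
    1 one_pos
  exact ⟨1, 1, T₁, one_pos, by norm_num, one_pos, hT₁, h⟩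

/-- **EQUIVALENCE CERTIFICATE, BY NAME: `OneSidedRadialCriterion ↔` ONE THIN SUBCRITICAL CORE** (the recommended
reshape of the registered stub `stub_subcriticalCoreReynolds`, `∀ ξ` weakened to `∃ ξ`; formally the weakest door of
the drift–diffusion road). Nothing is closed. [new] -/
theorem oneSidedRadialCriterion_iff_oneThinSubcriticalCore :
    OneSidedRadialCriterion ↔
    ∀ (ν T : ℝ), 0 < ν → 0 < T →
      ∀ (u : ℝ → EuclideanSpace ℝ (Fin 3) → EuclideanSpace ℝ (Fin 3)) (p : ℝ → EuclideanSpace ℝ (Fin 3) → ℝ),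
      IsClassicalNSSolutionOn (Ico 0 T) ν 0 u p → IsLerayHopfOn T ν 0 (u 0) u →
      (∀ T' < T, ∃ M : ℝ, ∀ t ∈ Icc 0 T', ∀ x, ‖u t x‖ ≤ M) →
      (∀ t ∈ Ico 0 T, IsAxisymmetric (u t)) → HasRapidSpatialDecay (u 0) →
      ∀ (C δ : ℝ), 0 < δ →
      (∀ t ∈ Ico 0 T, ∀ x : EuclideanSpace ℝ (Fin 3), cylRadius x < δ →
        -(C * ν) ≤ x 0 * u t x 0 + x 1 * u t x 1) →
      ∃ d₀ ξ T₁ : ℝ, 0 < d₀ ∧ d₀ < 2 ∧ 0 < ξ ∧ T₁ < T ∧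
        ∀ t ∈ Ico 0 T, T₁ ≤ t → ∀ x : EuclideanSpace ℝ (Fin 3), 0 < cylRadius x → cylRadius x < δ →
          cylRadius x < ξ * √(ν * (T - t)) → -(ν * d₀ / cylRadius x) ≤ radialVelocity (u t) x := by
  constructor
  · intro hX1 ν T hν hT u p hcl hLH hbd hax hdec C δ hδ hgate
    exact (hasSmoothExtensionPast_iff_oneThinSubcriticalCore hν hT hδ hcl hLH hbd hax hdec hgate).1
      (hX1 ν T hν hT u p hcl hLH hbd hax hdec ⟨C, δ, hδ, hgate⟩)
  · rintro h ν T hν hT u p hcl hLH hbd hax hdec ⟨C, δ, hδ, hgate⟩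
    exact hasSmoothExtensionPast_of_oneThinSubcriticalCore hν hT hδ hcl hLH hbd hax hdec hgate
      (h ν T hν hT u p hcl hLH hbd hax hdec C δ hδ hgate)

/-- **The registered stub (∀ ξ) and its thin-core weakening (∃ ξ) are equivalent, BY NAME** (both are the crux).
[new] -/
theorem subcriticalCoreReynolds_iff_oneThinSubcriticalCore :
    (∀ (ν T : ℝ), 0 < ν → 0 < T →
      ∀ (u : ℝ → EuclideanSpace ℝ (Fin 3) → EuclideanSpace ℝ (Fin 3)) (p : ℝ → EuclideanSpace ℝ (Fin 3) → ℝ),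
      IsClassicalNSSolutionOn (Ico 0 T) ν 0 u p → IsLerayHopfOn T ν 0 (u 0) u →
      (∀ T' < T, ∃ M : ℝ, ∀ t ∈ Icc 0 T', ∀ x, ‖u t x‖ ≤ M) →
      (∀ t ∈ Ico 0 T, IsAxisymmetric (u t)) → HasRapidSpatialDecay (u 0) →
      ∀ (C δ : ℝ), 0 < δ →
      (∀ t ∈ Ico 0 T, ∀ x : EuclideanSpace ℝ (Fin 3), cylRadius x < δ →
        -(C * ν) ≤ x 0 * u t x 0 + x 1 * u t x 1) →
      ∃ d₀ : ℝ, 0 < d₀ ∧ d₀ < 2 ∧ ∀ ξ : ℝ, 0 < ξ → ∃ T₁ : ℝ, T₁ < T ∧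
        ∀ t ∈ Ico 0 T, T₁ ≤ t → ∀ x : EuclideanSpace ℝ (Fin 3), 0 < cylRadius x → cylRadius x < δ →
          cylRadius x < ξ * √(ν * (T - t)) → -(ν * d₀ / cylRadius x) ≤ radialVelocity (u t) x) ↔
    ∀ (ν T : ℝ), 0 < ν → 0 < T →
      ∀ (u : ℝ → EuclideanSpace ℝ (Fin 3) → EuclideanSpace ℝ (Fin 3)) (p : ℝ → EuclideanSpace ℝ (Fin 3) → ℝ),
      IsClassicalNSSolutionOn (Ico 0 T) ν 0 u p → IsLerayHopfOn T ν 0 (u 0) u →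
      (∀ T' < T, ∃ M : ℝ, ∀ t ∈ Icc 0 T', ∀ x, ‖u t x‖ ≤ M) →
      (∀ t ∈ Ico 0 T, IsAxisymmetric (u t)) → HasRapidSpatialDecay (u 0) →
      ∀ (C δ : ℝ), 0 < δ →
      (∀ t ∈ Ico 0 T, ∀ x : EuclideanSpace ℝ (Fin 3), cylRadius x < δ →
        -(C * ν) ≤ x 0 * u t x 0 + x 1 * u t x 1) →
      ∃ d₀ ξ T₁ : ℝ, 0 < d₀ ∧ d₀ < 2 ∧ 0 < ξ ∧ T₁ < T ∧
        ∀ t ∈ Ico 0 T, T₁ ≤ t → ∀ x : EuclideanSpace ℝ (Fin 3), 0 < cylRadius x → cylRadius x < δ →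
          cylRadius x < ξ * √(ν * (T - t)) → -(ν * d₀ / cylRadius x) ≤ radialVelocity (u t) x := by
  rw [← oneSidedRadialCriterion_iff_subcriticalCoreReynolds, oneSidedRadialCriterion_iff_oneThinSubcriticalCore]

end Summit.NavierStokesRegularity.NavierStokesRegularity.Theorems.SubcriticalCoreReynolds

end
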